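import Summits.CriticalPhenomena.PercolationContinuityZ3.Theorems.PercNearOneGluingNoHeavyLowerTailFKHullPortDeltaNTools
import Summits.CriticalPhenomena.PercolationContinuityZ3.Theorems.PercNearOneGluingNoHeavyLowerTailHullPortTAStep
import HarnessLib

/-!
# FK sub-lane: Lemma `Δ_N` for the random-cluster measure `φ_{𝐩,q}` by a second Bernstein deformation (the induction)

Support file (`--supports stmt-CriticalPhenomena-4575`), FK sub-lane `prim-bschramm-fk-2` (gen 3); builds on p205010 (kernel theorem,
internal audit signed; external expert review pending).  No definitions, no named facts, no sorries; standard axioms.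

Part 2 (the induction) of the Lean proof of THE LOCATED OPEN LEMMA OF THE FK FINITE LEG (lane VERDICT V40: "(Δ) = Lemma Δ_N for FK: Cov_{φ(·|C_y ∌ s,x)}(Ψ_{s,y,U}(C_x), ω_e) ≤ 0
for e = xv at x"), in the sum-level vocabulary of `…FKHullPortTADefs.lean` and for an avoided vertex SET `X` (bschramm/FK-Q2.md §12):
for `q ≥ 1`, a weight vector `w` whose weight-`1` pairs lie inside `X` (they encode earlier contractions), and a pair `e = s(a,b)`
touching `X` (`a ∈ X`) with `0 < w e < 1`,
  `B(w[e↦1], X∪{b}) · b(w[e↦0], X) ≤ B(w[e↦0], X) · b(w[e↦1], X∪{b})`,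
where `(w[e↦1], X∪{b})` is the honest contraction `G/e` and `(w[e↦0], X)` the deletion `G∖e`; i.e. contracting an edge at the avoided
set lowers `E[Ψ(C_X) | C_y ∌ s, C_y ∩ X = ∅]`.  The q = 1 proof (prim-hp-7 HP7-MDLX-PROOF §4, prove-5 `HullPort.deltaN_nonneg`) couples
`K₁ = K₀ ∪ C_v` on ONE product measure; for `q > 1` that coupling leaves a cross-measure term (FK-Q2 §11.3 (IIa)).  The FK proof uses NO
coupling: a SECOND one-edge Bernstein deformation at another fractional pair `f` touching `X` makes the claim a quadratic in `w f` whose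
endpoint coefficients and whose `B·b` cross factor are instances of the claim at smaller states, and whose other cross factor is the positive
correlation of `ω_e, ω_f` given avoidance (van den Berg–Häggström–Kahn Thm 2.1 for `φ_{𝐩,q}`); the single-fractional-pair case is prim-hp-7's
Lemma `P_v` for `φ_{𝐩,q}` after a Markov factorisation (vdBHK Lemma 2.3) and a constant tilt `q⁻¹`.

THIS FILE: `FK.deltaN_nonneg_of_single` — the claim for EVERY fractional pair touching `X` (exits and internal pairs) by strong induction on
`(|V∖X|, #fractional pairs touching X)` from its single-fractional-pair case `hBase` (discharged in `…FKHullPortDeltaNBase.lean`), using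
the section identities (`…FKHullPortTASections.lean`), prove-5's `HullPort.bernstein_step`/`bernstein_step_degenerate`, and `FK.tab_posCorr`.
[cite: VandenbergHaggstromKahn2005, Thm. 2.1 (p. 9); §1 pp. 3–5; §2.1 Lemmas 2.2–2.3 (p. 10)]
[cite: Grimmett2006, §1.4 eq. (1.20) (p. 15); Thm. (3.1)(a) (p. 37); Thm. (3.8)(b)]
-/

noncomputable section

namespace Summit.CriticalPhenomena.PercolationContinuityZ3.Theorems.FK

open MeasureTheory Set Literature.Probability.LatticeModels Literature.Probability.Percolation
open Literature.Probability.Percolation.DecisionTree (ind ind_of_mem ind_of_not_mem ind_nonneg)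
open Literature.Probability.Percolation.BHK2006 (rcMass delW)
open Summit.CriticalPhenomena.PercolationContinuityZ3.Theorems.HullPort (cut avoidEv)
open scoped Classical

variable {V : Type*} [Fintype V]

section DeltaN

open Literature.Probability.Percolation.BHK2006 (weight rcMass_fkg rcMass_nonneg openEdgeCluster_mono coe_delW)
open Summit.CriticalPhenomena.PercolationContinuityZ3.Theorems.HullPort (insert_mem_avoidEv_iff cut_insert_edge
  edge_mem_cut eq_of_reachable_of_isolated mem_cut_of_mem bernstein_step bernstein_step_degenerate)

/-! ### The induction -/

/-- **Lemma `Δ_N` for the random-cluster measure `φ_{𝐩,q}`, `q ≥ 1`, from its single-pair case** (bschramm/FK-Q2.md §12.2).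
For every weight vector `w` whose weight-`1` pairs lie inside the avoided set `X` and every pair `e = s(a,b)` touching `X`
(`a ∈ X`) with `0 < w e < 1`:
  `B(w[e↦1], X∪{b})·b(w[e↦0], X) ≤ B(w[e↦0], X)·b(w[e↦1], X∪{b})`,
i.e. `E_{G/e}[Ψ(C_X) | C_y ∌ s, C_y ∩ X = ∅] ≤ E_{G∖e}[Ψ(C_X) | …]` — contracting an edge at the avoided set lowers the conditional
expected slack.  PROOF: strong induction on `(|V∖X|, #fractional pairs touching X)`; if another fractional pair `f = s(c,d)`
touches `X`, the four quantities are affine in `w f` (section identities), the claim is a Bernstein quadratic whose endpoint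
coefficients and whose cross term `B·b`-factor are instances of the claim at smaller states (`HullPort.bernstein_step`), and the
remaining cross factor is the positive correlation of `ω_e, ω_f` given avoidance (`FK.tab_posCorr`, from van den Berg–Häggström–Kahn
Thm 2.1 for `φ_{𝐩,q}`); if `e` is the only fractional pair touching `X`, the claim is the hypothesis `hBase` (= prim-hp-7's Lemma
`P_v` for `φ_{𝐩,q}` after a Markov factorisation, FK-Q2 §12.2 CASE B / §12.3).  No cross-measure term appears (contrast FK-Q2 §11.3 (IIa)).
[cite: VandenbergHaggstromKahn2005, Thm. 2.1 (p. 9); §1 pp. 3–5] [cite: Grimmett2006, Thm. (3.1)(a), Thm. (3.8)(b), eq. (1.20)] -/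
theorem deltaN_nonneg_of_single {q : ℝ} (hq : 1 ≤ q) (s y : V) (hsy : s ≠ y) (g : Set (Sym2 V) → ℝ) (hg : Monotone g)
    (hBase : ∀ (w : Sym2 V → unitInterval) (X : Set V),
      (∀ p : Sym2 V, ((w p : unitInterval) : ℝ) = 1 → ∀ u ∈ p, u ∈ X) → s ∉ X → y ∉ X →
      ∀ a b : V, a ∈ X → a ≠ b → b ≠ s → b ≠ y →
      0 < ((w s(a, b) : unitInterval) : ℝ) → ((w s(a, b) : unitInterval) : ℝ) < 1 →
      (∀ p : Sym2 V, ¬ p.IsDiag → (∃ c ∈ p, c ∈ X) → p ≠ s(a, b) →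
          ((w p : unitInterval) : ℝ) = 0 ∨ ((w p : unitInterval) : ℝ) = 1) →
      0 ≤ taB (Function.update w s(a, b) 0) q s y X g * tab (Function.update w s(a, b) 1) q s y (insert b X) -
          taB (Function.update w s(a, b) 1) q s y (insert b X) g * tab (Function.update w s(a, b) 0) q s y X)
    (w : Sym2 V → unitInterval) (X : Set V) (hINV : ∀ p : Sym2 V, ((w p : unitInterval) : ℝ) = 1 → ∀ u ∈ p, u ∈ X)
    {a b : V} (ha : a ∈ X) (hab : a ≠ b) (h0 : 0 < ((w s(a, b) : unitInterval) : ℝ))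
    (h1 : ((w s(a, b) : unitInterval) : ℝ) < 1) :
    0 ≤ taB (Function.update w s(a, b) 0) q s y X g * tab (Function.update w s(a, b) 1) q s y (insert b X) -
        taB (Function.update w s(a, b) 1) q s y (insert b X) g * tab (Function.update w s(a, b) 0) q s y X := by
  classical
  have hq0 : 0 < q := one_pos.trans_le hq
  set M : ℕ := Fintype.card (Sym2 V) with hM
  -- the two parts of the induction measure `|V ∖ X|·(M+1) + #{fractional pairs touching X}` (as local functions, so that
  -- every instance of them carries the same decidability instances)
  set cV : Set V → ℕ := fun X => (Finset.univ.filter (fun u : V => u ∉ X)).card with hcV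
  set cF : (Sym2 V → unitInterval) → Set V → ℕ := fun w X =>
    (Finset.univ.filter (fun p : Sym2 V => ¬ p.IsDiag ∧ (∃ c ∈ p, c ∈ X) ∧
      0 < ((w p : unitInterval) : ℝ) ∧ ((w p : unitInterval) : ℝ) < 1)).card with hcF
  have main : ∀ (N : ℕ) (w : Sym2 V → unitInterval) (X : Set V),
      (∀ p : Sym2 V, ((w p : unitInterval) : ℝ) = 1 → ∀ u ∈ p, u ∈ X) → cV X * (M + 1) + cF w X = N →
      ∀ a b : V, a ∈ X → a ≠ b → 0 < ((w s(a, b) : unitInterval) : ℝ) → ((w s(a, b) : unitInterval) : ℝ) < 1 →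
      0 ≤ taB (Function.update w s(a, b) 0) q s y X g * tab (Function.update w s(a, b) 1) q s y (insert b X) -
          taB (Function.update w s(a, b) 1) q s y (insert b X) g * tab (Function.update w s(a, b) 0) q s y X := by
    intro N
    induction N using Nat.strong_induction_on with
    | _ N ih =>
    intro w X hINV hN a b ha hab h0 h1
    -- general facts about the measure
    have hFle : ∀ (w' : Sym2 V → unitInterval) (X' : Set V), cF w' X' ≤ M := by
      intro w' X'
      simp only [hcF]
      exact (Finset.card_le_card (Finset.filter_subset _ _)).trans (by rw [Finset.card_univ])
    have hFlt : ∀ (w' : Sym2 V → unitInterval) (X' : Set V) (p₀ : Sym2 V), (∀ p, p ≠ p₀ → w' p = w p) →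
        (((w' p₀ : unitInterval) : ℝ) = 0 ∨ ((w' p₀ : unitInterval) : ℝ) = 1) →
        (¬ p₀.IsDiag ∧ (∃ c ∈ p₀, c ∈ X) ∧ 0 < ((w p₀ : unitInterval) : ℝ) ∧ ((w p₀ : unitInterval) : ℝ) < 1) →
        (∀ u, u ∈ X' ↔ u ∈ X) → cF w' X' < cF w X := by
      intro w' X' p₀ hoff h01 hp₀ hXX
      simp only [hcF]
      apply Finset.card_lt_card
      rw [Finset.ssubset_iff_of_subset]
      · refine ⟨p₀, Finset.mem_filter.2 ⟨Finset.mem_univ _, hp₀⟩, fun h => ?_⟩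
        have h' := (Finset.mem_filter.1 h).2
        rcases h01 with h01 | h01
        · linarith [h'.2.2.1]
        · linarith [h'.2.2.2]
      · intro p hp
        have h' := (Finset.mem_filter.1 hp).2
        by_cases hpp : p = p₀
        · subst hpp
          rcases h01 with h01 | h01
          · linarith [h'.2.2.1]
          · linarith [h'.2.2.2]
        · rw [hoff p hpp] at h'
          obtain ⟨h1', ⟨c', hc'p, hc'X⟩, h3', h4'⟩ := h'
          exact Finset.mem_filter.2 ⟨Finset.mem_univ _, h1', ⟨c', hc'p, (hXX c').1 hc'X⟩, h3', h4'⟩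
    have hcVle : ∀ X₁ X₂ : Set V, X₁ ⊆ X₂ → cV X₂ ≤ cV X₁ := by
      intro X₁ X₂ h12
      simp only [hcV]
      apply Finset.card_le_card
      intro u hu
      exact Finset.mem_filter.2 ⟨Finset.mem_univ _, fun h => (Finset.mem_filter.1 hu).2 (h12 h)⟩
    have hcVlt : ∀ (X₁ X₂ : Set V) (d : V), X₁ ⊆ X₂ → d ∈ X₂ → d ∉ X₁ → cV X₂ < cV X₁ := by
      intro X₁ X₂ d h12 hd2 hd1
      simp only [hcV]
      apply Finset.card_lt_card
      rw [Finset.ssubset_iff_of_subset]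
      · exact ⟨d, Finset.mem_filter.2 ⟨Finset.mem_univ _, hd1⟩, fun h => (Finset.mem_filter.1 h).2 hd2⟩
      · intro u hu
        exact Finset.mem_filter.2 ⟨Finset.mem_univ _, fun h => (Finset.mem_filter.1 hu).2 (h12 h)⟩
    have hXlt : ∀ d : V, d ∉ X → cV (insert d X) < cV X := fun d hd =>
      hcVlt X (insert d X) d (Set.subset_insert _ _) (Set.mem_insert _ _) hd
    have hXle : ∀ d : V, cV (insert d X) ≤ cV X := fun d => hcVle X (insert d X) (Set.subset_insert _ _)
    -- measure decrease for the three kinds of smaller states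
    have hdec0 : ∀ (p₀ : Sym2 V), (¬ p₀.IsDiag ∧ (∃ c ∈ p₀, c ∈ X) ∧ 0 < ((w p₀ : unitInterval) : ℝ) ∧
        ((w p₀ : unitInterval) : ℝ) < 1) → cV X * (M + 1) + cF (Function.update w p₀ 0) X < N := by
      intro p₀ hp₀
      rw [← hN]
      have := hFlt (Function.update w p₀ 0) X p₀ (fun p hp => Function.update_of_ne hp _ _) (Or.inl (by simp)) hp₀
        (fun u => Iff.rfl)
      omega
    have hdec1 : ∀ (p₀ : Sym2 V) (d : V), d ∈ p₀ → (¬ p₀.IsDiag ∧ (∃ c ∈ p₀, c ∈ X) ∧ 0 < ((w p₀ : unitInterval) : ℝ) ∧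
        ((w p₀ : unitInterval) : ℝ) < 1) → cV (insert d X) * (M + 1) + cF (Function.update w p₀ 1) (insert d X) < N := by
      intro p₀ d hdp hp₀
      rw [← hN]
      by_cases hdX : d ∈ X
      · have hXX : ∀ u, u ∈ insert d X ↔ u ∈ X := fun u =>
          ⟨fun h => h.elim (fun h' => h' ▸ hdX) id, fun h => Set.mem_insert_of_mem _ h⟩
        have h1' := hFlt (Function.update w p₀ 1) (insert d X) p₀ (fun p hp => Function.update_of_ne hp _ _)
          (Or.inr (by simp)) hp₀ hXX
        have h2' := hXle d
        have h3 := Nat.mul_le_mul_right (M + 1) h2'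
        omega
      · have h1' := hXlt d hdX
        have h2' := hFle (Function.update w p₀ 1) (insert d X)
        have h3 := Nat.mul_le_mul_right (M + 1) (Nat.succ_le_of_lt h1')
        rw [Nat.succ_mul] at h3
        omega
    -- the induction hypothesis in usable form: any state with smaller measure
    have IH : ∀ (w' : Sym2 V → unitInterval) (X' : Set V),
        (∀ p : Sym2 V, ((w' p : unitInterval) : ℝ) = 1 → ∀ u ∈ p, u ∈ X') → cV X' * (M + 1) + cF w' X' < N →
        ∀ a' b' : V, a' ∈ X' → a' ≠ b' → 0 < ((w' s(a', b') : unitInterval) : ℝ) →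
          ((w' s(a', b') : unitInterval) : ℝ) < 1 →
        0 ≤ taB (Function.update w' s(a', b') 0) q s y X' g * tab (Function.update w' s(a', b') 1) q s y (insert b' X') -
          taB (Function.update w' s(a', b') 1) q s y (insert b' X') g * tab (Function.update w' s(a', b') 0) q s y X' :=
      fun w' X' hINV' hlt a' b' ha' hab' h0' h1' => ih _ hlt w' X' hINV' rfl a' b' ha' hab' h0' h1'
    set e : Sym2 V := s(a, b) with he
    have hediag : ¬ e.IsDiag := by rw [he, Sym2.mk_isDiag_iff]; exact hab
    -- trivial cases
    by_cases hyX : y ∈ X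
    · rw [taB_eq_zero_of_mem (Function.update w e 0) q hsy X hyX g,
        tab_eq_zero_of_mem (Function.update w e 0) q s y X (Set.mem_insert_of_mem _ hyX)]
      simp
    by_cases hby : b = y
    · rw [hby, taB_eq_zero_of_mem (Function.update w e 1) q hsy (insert y X) (Set.mem_insert _ _) g,
        tab_eq_zero_of_mem (Function.update w e 1) q s y (insert y X) (Set.mem_insert_of_mem _ (Set.mem_insert _ _))]
      simp
    by_cases hsX : s ∈ X
    · rw [taB_eq_zero_of_root_mem (Function.update w e 0) q s y X hsX g,
        taB_eq_zero_of_root_mem (Function.update w e 1) q s y (insert b X) (Set.mem_insert_of_mem _ hsX) g]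
      simp
    by_cases hbs : b = s
    · rw [hbs, taB_eq_zero_of_root_mem (Function.update w e 1) q s y (insert s X) (Set.mem_insert _ _) g, zero_mul,
        sub_zero]
      exact mul_nonneg (taB_nonneg _ hq s y X hg) (tab_nonneg _ hq0.le s y _)
    -- the other fractional pairs touching `X`
    set F' : Finset (Sym2 V) := Finset.univ.filter (fun p : Sym2 V => ¬ p.IsDiag ∧ (∃ c ∈ p, c ∈ X) ∧
      0 < ((w p : unitInterval) : ℝ) ∧ ((w p : unitInterval) : ℝ) < 1 ∧ p ≠ e) with hF'
    by_cases hF'0 : F' = ∅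
    · -- BASE: `e` is the only fractional pair touching `X`
      refine hBase w X hINV hsX hyX a b ha hab hbs hby h0 h1 fun p hpd hpc hpe => ?_
      by_contra hcon
      have hw0 : 0 ≤ ((w p : unitInterval) : ℝ) := (w p).2.1
      have hw1 : ((w p : unitInterval) : ℝ) ≤ 1 := (w p).2.2
      have hne0 : ((w p : unitInterval) : ℝ) ≠ 0 := fun h => hcon (Or.inl h)
      have hne1 : ((w p : unitInterval) : ℝ) ≠ 1 := fun h => hcon (Or.inr h)
      have : p ∈ F' := by
        rw [hF', Finset.mem_filter]
        exact ⟨Finset.mem_univ _, hpd, hpc, lt_of_le_of_ne hw0 (Ne.symm hne0), lt_of_le_of_ne hw1 hne1, hpe⟩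
      rw [hF'0] at this
      exact absurd this (Finset.notMem_empty _)
    · -- STEP: a second fractional pair `f = s(c,d)` touching `X`
      obtain ⟨f, hfF⟩ := Finset.nonempty_iff_ne_empty.2 hF'0
      obtain ⟨hfd, ⟨c, hcf, hcX⟩, hf0, hf1, hfe⟩ := (Finset.mem_filter.1 hfF).2
      set d : V := Sym2.Mem.other hcf with hd
      have hfcd : f = s(c, d) := (Sym2.other_spec hcf).symm
      have hcd : c ≠ d := fun h => Sym2.other_ne hfd hcf h.symm
      have hef : e ≠ f := fun h => hfe h.symm
      have hef' : s(a, b) ≠ s(c, d) := by rw [← he, ← hfcd]; exact hef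
      -- the weight of `f` is unchanged by updating `e`
      have hw0f : ((Function.update w e 0 f : unitInterval) : ℝ) = ((w f : unitInterval) : ℝ) := by
        rw [Function.update_of_ne hfe]
      have hw1f : ((Function.update w e 1 f : unitInterval) : ℝ) = ((w f : unitInterval) : ℝ) := by
        rw [Function.update_of_ne hfe]
      set tf : ℝ := ((w f : unitInterval) : ℝ) with htf
      -- corner quantities `X_{ij}` = value at `w[e↦i][f↦j]`
      set A₀ := taB (Function.update (Function.update w e 0) f 0) q s y X g with hA₀
      set A₁ := taB (Function.update (Function.update w e 0) f 1) q s y (insert d X) g with hA₁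
      set a₀ := tab (Function.update (Function.update w e 0) f 0) q s y X with ha₀
      set a₁ := tab (Function.update (Function.update w e 0) f 1) q s y (insert d X) with ha₁
      set B₀ := taB (Function.update (Function.update w e 1) f 0) q s y (insert b X) g with hB₀
      set B₁ := taB (Function.update (Function.update w e 1) f 1) q s y (insert b (insert d X)) g with hB₁
      set b₀ := tab (Function.update (Function.update w e 1) f 0) q s y (insert b X) with hb₀
      set b₁ := tab (Function.update (Function.update w e 1) f 1) q s y (insert b (insert d X)) with hb₁
      -- section identities along `f`
      have sA : taB (Function.update w e 0) q s y X g = (1 - tf) * A₀ + tf * A₁ := by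
        have h := taB_sectionFK (Function.update w e 0) q s y c d X hcX g
        rw [← hfcd, hw0f] at h
        rw [h, hA₀, hA₁, hfcd]
      have sa : tab (Function.update w e 0) q s y X = (1 - tf) * a₀ + tf * a₁ := by
        have h := tab_sectionFK (Function.update w e 0) q s y c d X hcX
        rw [← hfcd, hw0f] at h
        rw [h, ha₀, ha₁, hfcd]
      have sB : taB (Function.update w e 1) q s y (insert b X) g = (1 - tf) * B₀ + tf * B₁ := by
        have h := taB_sectionFK (Function.update w e 1) q s y c d (insert b X) (Set.mem_insert_of_mem _ hcX) g
        rw [← hfcd, hw1f] at h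
        rw [h, hB₀, hB₁, hfcd, Set.insert_comm d b]
      have sb : tab (Function.update w e 1) q s y (insert b X) = (1 - tf) * b₀ + tf * b₁ := by
        have h := tab_sectionFK (Function.update w e 1) q s y c d (insert b X) (Set.mem_insert_of_mem _ hcX)
        rw [← hfcd, hw1f] at h
        rw [h, hb₀, hb₁, hfcd, Set.insert_comm d b]
      rw [sA, sa, sB, sb]
      have hexp : ((1 - tf) * A₀ + tf * A₁) * ((1 - tf) * b₀ + tf * b₁) - ((1 - tf) * B₀ + tf * B₁) * ((1 - tf) * a₀ + tf * a₁) =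
          ((1 - tf) * A₀ + tf * A₁) * ((1 - tf) * b₀ + tf * b₁) - ((1 - tf) * a₀ + tf * a₁) * ((1 - tf) * B₀ + tf * B₁) := by
        ring
      rw [hexp]
      have htf0 : 0 ≤ tf := hf0.le
      have htf1 : tf ≤ 1 := hf1.le
      -- INV for the corner states
      have hINVe0 : ∀ p : Sym2 V, ((Function.update w e 0 p : unitInterval) : ℝ) = 1 → ∀ u ∈ p, u ∈ X := by
        intro p hp u hu
        by_cases hpe : p = e
        · subst hpe; simp at hp
        · rw [Function.update_of_ne hpe] at hp; exact hINV p hp u hu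
      have hINVf0 : ∀ p : Sym2 V, ((Function.update w f 0 p : unitInterval) : ℝ) = 1 → ∀ u ∈ p, u ∈ X := by
        intro p hp u hu
        by_cases hpf : p = f
        · subst hpf; simp at hp
        · rw [Function.update_of_ne hpf] at hp; exact hINV p hp u hu
      have hINVf1 : ∀ p : Sym2 V, ((Function.update w f 1 p : unitInterval) : ℝ) = 1 → ∀ u ∈ p, u ∈ insert d X := by
        intro p hp u hu
        by_cases hpf : p = f
        · subst hpf
          rw [hfcd] at hu
          rcases Sym2.mem_iff.1 hu with rfl | rfl
          · exact Set.mem_insert_of_mem _ hcX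
          · exact Set.mem_insert _ _
        · rw [Function.update_of_ne hpf] at hp; exact Set.mem_insert_of_mem _ (hINV p hp u hu)
      have hINVe1 : ∀ p : Sym2 V, ((Function.update w e 1 p : unitInterval) : ℝ) = 1 → ∀ u ∈ p, u ∈ insert b X := by
        intro p hp u hu
        by_cases hpe : p = e
        · subst hpe
          rw [he] at hu
          rcases Sym2.mem_iff.1 hu with rfl | rfl
          · exact Set.mem_insert_of_mem _ ha
          · exact Set.mem_insert _ _
        · rw [Function.update_of_ne hpe] at hp; exact Set.mem_insert_of_mem _ (hINV p hp u hu)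
      -- Q₀₀ ≥ 0 : the claim at `(w[f↦0], X)` for the pair `e`
      have hfrac_f : ¬ f.IsDiag ∧ (∃ c ∈ f, c ∈ X) ∧ 0 < ((w f : unitInterval) : ℝ) ∧ ((w f : unitInterval) : ℝ) < 1 :=
        ⟨hfd, ⟨c, hcf, hcX⟩, hf0, hf1⟩
      have hfrac_e : ¬ e.IsDiag ∧ (∃ c ∈ e, c ∈ X) ∧ 0 < ((w e : unitInterval) : ℝ) ∧ ((w e : unitInterval) : ℝ) < 1 :=
        ⟨hediag, ⟨a, by rw [he]; exact Sym2.mem_mk_left _ _, ha⟩, h0, h1⟩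
      have hN0 : cV X * (M + 1) + cF (Function.update w f 0) X < N := hdec0 f hfrac_f
      have hQ0 : 0 ≤ A₀ * b₀ - a₀ * B₀ := by
        have h := IH (Function.update w f 0) X hINVf0 hN0 a b ha hab
          (by rw [← he, Function.update_of_ne hef]; exact h0) (by rw [← he, Function.update_of_ne hef]; exact h1)
        rw [← he, Function.update_comm hfe, Function.update_comm hfe] at h
        rw [hA₀, hb₀, ha₀, hB₀]
        linarith [h]
      by_cases hdy : d = y
      · -- degenerate step: the `f`-contracted corner absorbs `y`
        have hA₁0 : A₁ = 0 := by rw [hA₁, hdy]; exact taB_eq_zero_of_mem _ q hsy _ (Set.mem_insert _ _) g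
        have hB₁0 : B₁ = 0 := by
          rw [hB₁, hdy]; exact taB_eq_zero_of_mem _ q hsy _ (Set.mem_insert_of_mem _ (Set.mem_insert _ _)) g
        have ha₁0 : a₁ = 0 := by
          rw [ha₁, hdy]; exact tab_eq_zero_of_mem _ q s y _ (Set.mem_insert_of_mem _ (Set.mem_insert _ _))
        have hb₁0 : b₁ = 0 := by
          rw [hb₁, hdy]
          exact tab_eq_zero_of_mem _ q s y _ (Set.mem_insert_of_mem _ (Set.mem_insert_of_mem _ (Set.mem_insert _ _)))
        exact bernstein_step_degenerate A₀ A₁ B₀ B₁ a₀ a₁ b₀ b₁ tf hQ0 hA₁0 hB₁0 ha₁0 hb₁0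
      · -- regular step
        -- Q₁₁ ≥ 0 : the claim at `(w[f↦1], X ∪ {d})` for the pair `e`
        have hN1 : cV (insert d X) * (M + 1) + cF (Function.update w f 1) (insert d X) < N :=
          hdec1 f d (by rw [hfcd]; exact Sym2.mem_mk_right _ _) hfrac_f
        have hQ1 : 0 ≤ A₁ * b₁ - a₁ * B₁ := by
          have h := IH (Function.update w f 1) (insert d X) hINVf1 hN1 a b (Set.mem_insert_of_mem _ ha) hab
            (by rw [← he, Function.update_of_ne hef]; exact h0) (by rw [← he, Function.update_of_ne hef]; exact h1)
          rw [← he, Function.update_comm hfe, Function.update_comm hfe] at h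
          rw [hA₁, hb₁, ha₁, hB₁]
          linarith [h]
        -- Δ̂ ≥ 0 : the claim at `(w[e↦1], X ∪ {b})` for the pair `f`
        have hN2 : cV (insert b X) * (M + 1) + cF (Function.update w e 1) (insert b X) < N :=
          hdec1 e b (by rw [he]; exact Sym2.mem_mk_right _ _) hfrac_e
        have hΔ : 0 ≤ B₀ * b₁ - B₁ * b₀ := by
          have h := IH (Function.update w e 1) (insert b X) hINVe1 hN2 c d (Set.mem_insert_of_mem _ hcX) hcd
            (by rw [← hfcd, Function.update_of_ne hfe]; exact hf0) (by rw [← hfcd, Function.update_of_ne hfe]; exact hf1)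
          rw [← hfcd, Set.insert_comm d b] at h
          rw [hB₀, hb₁, hB₁, hb₀]
          linarith [h]
        -- the cross factor: positive correlation of `ω_e, ω_f` given avoidance
        have hL : 0 ≤ a₀ * b₁ - a₁ * b₀ := by
          have h := tab_posCorr w hq (s := s) (y := y) X ha hab hcX hcd hef' h0 h1
            (by rw [← hfcd]; exact hf0) (by rw [← hfcd]; exact hf1)
          rw [← he, ← hfcd] at h
          rw [ha₀, hb₁, ha₁, hb₀]
          linarith [h]
        -- positivity of the two `b`'s
        have hINV10 : ∀ p : Sym2 V, ((Function.update (Function.update w e 1) f 0 p : unitInterval) : ℝ) = 1 →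
            ∀ u ∈ p, u ∈ insert b X := by
          intro p hp u hu
          by_cases hpf : p = f
          · subst hpf; simp at hp
          · rw [Function.update_of_ne hpf] at hp; exact hINVe1 p hp u hu
        have hINV11 : ∀ p : Sym2 V, ((Function.update (Function.update w e 1) f 1 p : unitInterval) : ℝ) = 1 →
            ∀ u ∈ p, u ∈ insert b (insert d X) := by
          intro p hp u hu
          by_cases hpf : p = f
          · subst hpf
            rw [hfcd] at hu
            rcases Sym2.mem_iff.1 hu with rfl | rfl
            · exact Set.mem_insert_of_mem _ (Set.mem_insert_of_mem _ hcX)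
            · exact Set.mem_insert_of_mem _ (Set.mem_insert _ _)
          · rw [Function.update_of_ne hpf] at hp
            rw [Set.insert_comm]
            exact Set.mem_insert_of_mem _ (hINVe1 p hp u hu)
        have hybX : y ∉ insert b X := by
          rintro (h | h)
          · exact hby h.symm
          · exact hyX h
        have hybdX : y ∉ insert b (insert d X) := by
          rintro (h | h | h)
          · exact hby h.symm
          · exact hdy h.symm
          · exact hyX h
        have hb₀pos : 0 < b₀ := tab_pos _ hq0 hsy (insert b X) hINV10 hybX
        have hb₁pos : 0 < b₁ := tab_pos _ hq0 hsy (insert b (insert d X)) hINV11 hybdX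
        exact bernstein_step A₀ A₁ B₀ B₁ a₀ a₁ b₀ b₁ tf htf0 htf1 hQ0 hQ1 hΔ hL hb₀pos hb₁pos
  exact main _ w X hINV rfl a b ha hab h0 h1

end DeltaN

end Summit.CriticalPhenomena.PercolationContinuityZ3.Theorems.FK

end
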